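import Literature.NumberTheory.Sieve.DrappeauDispersionR1ppFinal
import Literature.NumberTheory.Sieve.KloostermanQuintilinearCongruences
import HarnessLib

/-!
# Drappeau 2017, Theorem 5.1 — closure of the named fact `Drappeau2017_theorem51` (reserved file)

Topic `Literature/NumberTheory/Sieve`.  The whole of §5 of S. Drappeau, *Sums of Kloosterman sums in
arithmetic progressions, and the error term in the dispersion method*, Proc. London Math. Soc. (3) 114
(2017) 684–732 = arXiv:1504.05549, is formalised in the `DrappeauDispersion*.lean` /
`KloostermanQuintilinear*.lean` files, ending with
`Drappeau2017_theorem51_of_ABL23 (HX : <Theorem 2.1>) : Drappeau2017_theorem51`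
(`DrappeauDispersionR1ppFinal.lean`).  Theorem 2.1 (= Assing–Blomer–Li 2021, Theorem 2.3 with `a = 1`,
the last term of `K` corrected to `D²NR`) is the named fact `AssingBlomerLi2020_theorem23` of
`KloostermanQuintilinearCongruences.lean`, whose def body is VERBATIM the binder `HX`.

Consequently users holding `h : AssingBlomerLi2020_theorem23` write
`Drappeau2017_theorem51_of_ABL23 h` directly (the `def` unfolds during elaboration).  The former
one-line wrapper `Drappeau2017_theorem51_holds_of` was exactly that term — an alias found by the
gate's alias probe (work item `dedup-02595`); it survives below only as a `@[deprecated]` pointer to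
`Drappeau2017_theorem51_of_ABL23` (this file is the reserved home of the unconditional discharge and
may not be empty), and nothing in the tree uses it.  The unconditional
`theorem Drappeau2017_theorem51_holds : Drappeau2017_theorem51 :=
Drappeau2017_theorem51_of_ABL23 AssingBlomerLi2020_theorem23_holds`
is appended to THIS file the moment `AssingBlomerLi2020_theorem23_holds` (Kuznetsov formula with
nebentypus + spectral large sieve; Assing–Blomer–Li §§3–7) exists.  No definition, no named fact.

## References

* S. Drappeau, Proc. London Math. Soc. (3) 114 (2017) 684–732, Theorem 5.1, §5. [cite: Drappeau2017, Theorem 5.1]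
* E. Assing, V. Blomer, J. Li, Adv. Math. 393 (2021) 108076, Theorem 2.3. [cite: AssingBlomerLi2020, Theorem 2.3]
-/

namespace Literature.NumberTheory.Sieve

/-- Deprecated alias: use `Drappeau2017_theorem51_of_ABL23 h` (the named fact
`AssingBlomerLi2020_theorem23` is verbatim its binder `HX`). [cite: Drappeau2017, Theorem 5.1] -/
@[deprecated Drappeau2017_theorem51_of_ABL23 (since := "2026-08-16")]
theorem Drappeau2017_theorem51_holds_of (h : AssingBlomerLi2020_theorem23) :
    Drappeau2017_theorem51 :=
  Drappeau2017_theorem51_of_ABL23 h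

end Literature.NumberTheory.Sieve
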